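import Literature.Analysis.FluidPDE.OnsagerBDSVEnergyPrincipal
import Literature.Analysis.FluidPDE.OnsagerBDSVNonstationaryPhase
import Literature.Analysis.FluidPDE.OnsagerBDSVDeformationBoundsProofs
import Literature.Analysis.FluidPDE.OnsagerBDSVEnergyCorrectorHolds
import Literature.Analysis.FluidPDE.OnsagerBDSVPrincipalPartBound
import HarnessLib

/-!
# The BDSV energy estimate, oscillatory term: the phase frame of the construction (tools)

Buckmaster–De Lellis–Székelyhidi–Vicol (BDSV), *Onsager's conjecture for admissible weak
solutions*, CPAM 72 (2019) = arXiv:1701.08678, proof of Prop. 6.2, last paragraph ("Set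
`e_{q,i} := ρ_{q,i} ∇Φ_i⁻¹ tr C_k(R̃_i) ∇Φ_i⁻ᵀ` and use Proposition 5.7 and Lemma 5.4 to conclude
`‖e_{q,i}‖_N ≲ δ_{q+1} ℓ^{-N}` …"). This file verifies, for the honest objects of the
construction (`OnsagerBDSVPerturbation.lean`), the hypotheses of the non-stationary phase bound
of `OnsagerBDSVNonstationaryPhase.lean` (`BDSV.PhaseFrame`) at every time at which the cut-off
`η_i` is active; the discharge of G₃′/G₃ itself is `OnsagerBDSVEnergyPrincipalProofs.lean`.

* `BDSV.gradPhiBound_allOrders` — Prop. 5.7, arXiv (5.23), at all orders `k ≤ K` along ONE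
  prefix (maxima of the `N̄`, constants and thresholds of the proved `BDSV.gradPhiBound_holds`);
* entries: `BDSV.scaledBound_entry` (a Hölder bound on a matrix field gives
  `BDSV.ScaledBound` on each entry), `BDSV.eContDiffHolderNorm_colEntry_le`, `BDSV.scaledBound_const`;
* the mean-free Mikado tensor as a zero-mean profile: `BDSV.MikadoDatum.fluctFam a b` (entries of
  `W ⊗ W - R`), its globally mean-corrected version `BDSV.MikadoDatum.fluctZ` (zero mean for EVERY
  `R`, jointly smooth, and equal to the fluctuation on the Mikado ball by `⨍ W ⊗ W = R`,
  `BDSV.MikadoDatum.fluctZ_eq_of_mem`), and uniform bounds for all its descendants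
  (`BDSV.MikadoDatum.exists_bound_descSet_fluctZ`);
* `BDSV.PerturbationData.scaledBound_tildeR` — arXiv (5.24) in entrywise scaled form:
  `‖(R̃_{q,i})_{ab}(t)‖_{C^k} ≤ 9(3^K(K+1))² C_J² (1 + 24C_in) ℓ^{-k}` from (5.23) at all orders,
  (2.20) (`BDSV.PerturbationHypotheses.scaledBound_Rbar`), `c = ∑∫η²/ρ_q ≤ 8λ_q^α/δ_{q+1}`
  (`BDSV.PerturbationData.etaMass_div_rhoQ_le` of `OnsagerBDSVDeformationBoundsTildeR.lean`, which
  proves the matrix-norm form `BDSV.tildeRBound_holds` of (5.24); here the entrywise all-orders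
  form along one prefix is what the phase frame consumes) and `λ_q^αℓ^α ≤ 1`, by Leibniz on
  `R̃ = ∇Φ(Id - cR̊̄)∇Φᵀ`;
* `BDSV.PerturbationData.phaseFrame` — at an active time the data
  `(R̃_{q,i}(t), D_i(t), n_{q+1}, K, ℓ, Λ, B̄(Id,1/10))` form a `BDSV.PhaseFrame` with
  `Λ = BDSV.frameConst K C_J C_in` (`det ∇Φ_i = 1`, `∇Φ_i⁻¹ = adj ∇Φ_i`, Lemma 5.4
  `BDSV.PerturbationData.tildeR_mem_closedBall`).

## References

* T. Buckmaster, C. De Lellis, L. Székelyhidi Jr., V. Vicol, *Onsager's conjecture for admissible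
  weak solutions*, Comm. Pure Appl. Math. 72 (2019) 229–274 = arXiv:1701.08678: proof of
  Prop. 6.2 (last paragraph); §5.1 Lemma 5.1, (5.6); §5.2, Lemma 5.4; §5.5 Prop. 5.7
  (arXiv (5.23)–(5.24)); §2.5 (2.20).
-/

open MeasureTheory Set Filter
open scoped NNReal ENNReal ContDiff Matrix Matrix.Norms.Elementwise

noncomputable section

namespace Literature.Analysis.FluidPDE

namespace BDSV

open FunctionSpaces FunctionSpaces.Torus

/-- The flat three-torus `T³ = (ℝ/ℤ)³`, local notation. -/
local notation "𝕋³" => UnitAddTorus (Fin 3)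

/-- Euclidean `ℝ³`, local notation. -/
local notation "ℝ³" => EuclideanSpace ℝ (Fin 3)

/-- Real `3 × 3` matrices, local notation. -/
local notation "𝕄" => Matrix (Fin 3) (Fin 3) ℝ

/-! ## The deformation bounds at all orders up to `K` -/

section AllOrders

/-- **Prop. 5.7 (arXiv (5.23)) at all orders `k ≤ K` along one prefix**: the proved fact
`BDSV.gradPhiBound` (`BDSV.gradPhiBound_holds`) delivers, for each `N`, a number of derivatives
`N̄(N)`, a constant and a threshold; taking maxima over `N ≤ K` gives one `N̄`, one constant `C` and
one threshold `a₀` for which `‖∇Φ_i‖_{C^k}, ‖(∇Φ_i)⁻¹‖_{C^k} ≤ C ℓ^{-k}` on `Ĩ_i` for every `k ≤ K`.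
[cite: BuckmasterEtAl2018, Prop. 5.7 (arXiv (5.23))] -/
theorem gradPhiBound_allOrders :
    ∀ (c₀ : ℝ), 0 < c₀ → ∀ Cη : ℕ → ℕ → ℝ,
      ∀ β : ℝ, 0 < β → β < 1 / 3 → ∀ b : ℝ, 1 < b → b < (1 - β) / (2 * β) →
        ∃ α₀ : ℝ, 0 < α₀ ∧ ∀ α : ℝ, 0 < α → α < α₀ → ∀ K : ℕ, ∃ Nbar : ℕ, ∀ Cin C₀ : ℝ,
          ∃ C a₀ : ℝ, 1 < a₀ ∧ ∀ a : ℝ, a₀ ≤ a → ∀ S : Setting,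
            PerturbationHypotheses ⟨β, α, a, b⟩ S Nbar Cin C₀ →
              ∀ (𝒟 : PerturbationData ⟨β, α, a, b⟩ S c₀ Cη) (i : ℕ), ∀ k ≤ K,
                HolderSupOnLE (tildeInterval S.T (Params.τ ⟨β, α, a, b⟩ S.q) i)
                    (fun t x => gradPhi 𝒟.D i t x) k 0
                    (C * mollScale β α a b S.q ^ (-(k : ℝ))) ∧
                  HolderSupOnLE (tildeInterval S.T (Params.τ ⟨β, α, a, b⟩ S.q) i)
                    (fun t x => (gradPhi 𝒟.D i t x)⁻¹) k 0
                    (C * mollScale β α a b S.q ^ (-(k : ℝ))) := by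
  intro c₀ hc₀ Cη β hβ hβ' b hb hb'
  obtain ⟨α₀, hα₀, hG⟩ := gradPhiBound_holds c₀ hc₀ Cη β hβ hβ' b hb hb'
  refine ⟨α₀, hα₀, fun α hα hαlt => ?_⟩
  have hGα := hG α hα hαlt
  intro K
  induction K with
  | zero =>
    obtain ⟨Nbar, hN⟩ := hGα 0
    refine ⟨Nbar, fun Cin C₀ => ?_⟩
    obtain ⟨C, a₀, ha₀, hC⟩ := hN Cin C₀
    refine ⟨C, a₀, ha₀, fun a ha S H 𝒟 i k hk => ?_⟩
    obtain rfl : k = 0 := Nat.le_zero.1 hk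
    exact hC a ha S H 𝒟 i
  | succ K ih =>
    obtain ⟨N₁, h₁⟩ := ih
    obtain ⟨N₂, h₂⟩ := hGα (K + 1)
    refine ⟨max N₁ N₂, fun Cin C₀ => ?_⟩
    obtain ⟨C₁, a₁, ha₁, hC₁⟩ := h₁ Cin C₀
    obtain ⟨C₂, a₂, ha₂, hC₂⟩ := h₂ Cin C₀
    refine ⟨max C₁ C₂, max a₁ a₂, lt_max_of_lt_left ha₁, fun a ha S H 𝒟 i k hk => ?_⟩
    have ha1 : (1 : ℝ) ≤ a := ha₁.le.trans ((le_max_left _ _).trans ha)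
    have hℓk : 0 ≤ mollScale β α a b S.q ^ (-(k : ℝ)) :=
      Real.rpow_nonneg (mollScale_pos ha1 _).le _
    rcases Nat.lt_or_ge k (K + 1) with hlt | hge
    · have h := hC₁ a ((le_max_left _ _).trans ha) S (H.of_le (le_max_left _ _)) 𝒟 i k
        (Nat.lt_succ_iff.1 hlt)
      exact ⟨h.1.mono (mul_le_mul_of_nonneg_right (le_max_left _ _) hℓk),
        h.2.mono (mul_le_mul_of_nonneg_right (le_max_left _ _) hℓk)⟩
    · obtain rfl : k = K + 1 := le_antisymm hk hge
      have h := hC₂ a ((le_max_right _ _).trans ha) S (H.of_le (le_max_right _ _)) 𝒟 i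
      exact ⟨h.1.mono (mul_le_mul_of_nonneg_right (le_max_right _ _) hℓk),
        h.2.mono (mul_le_mul_of_nonneg_right (le_max_right _ _) hℓk)⟩

end AllOrders

/-! ## From Hölder bounds on matrix fields to scaled bounds on entries -/

section Entries

variable {K : ℕ} {ℓ : ℝ}

/-- The evaluation of an entry of a `3 × 3` matrix is a continuous linear map of norm at most one
(elementwise sup norm). [folklore] -/
def entryCLM (a b : Fin 3) : (Fin 3 → Fin 3 → ℝ) →L[ℝ] ℝ :=
  (ContinuousLinearMap.proj b).comp
    (ContinuousLinearMap.proj (R := ℝ) (φ := fun _ : Fin 3 => Fin 3 → ℝ) a)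

/-- `entryCLM a b M = M a b`. [folklore] -/
@[simp] theorem entryCLM_apply (a b : Fin 3) (M : Fin 3 → Fin 3 → ℝ) : entryCLM a b M = M a b := rfl

/-- `‖entryCLM a b‖ ≤ 1`. [folklore] -/
theorem enorm_entryCLM_le (a b : Fin 3) : ‖entryCLM a b‖ₑ ≤ 1 := by
  rw [← ofReal_norm, ← ENNReal.ofReal_one]
  refine ENNReal.ofReal_le_ofReal (ContinuousLinearMap.opNorm_le_bound _ zero_le_one fun M => ?_)
  rw [entryCLM_apply, one_mul]
  exact (norm_le_pi_norm (M a) b).trans (norm_le_pi_norm M a)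

/-- The evaluation of an entry of a family of columns `Fin 3 → ℝ³` is a continuous linear map of
norm at most one. [folklore] -/
def colEntryCLM (l k : Fin 3) : (Fin 3 → ℝ³) →L[ℝ] ℝ :=
  (EuclideanSpace.proj k).comp (ContinuousLinearMap.proj (R := ℝ) (φ := fun _ : Fin 3 => ℝ³) l)

/-- `colEntryCLM l k R = R l k`. [folklore] -/
@[simp] theorem colEntryCLM_apply (l k : Fin 3) (R : Fin 3 → ℝ³) : colEntryCLM l k R = R l k := rfl

/-- `‖colEntryCLM l k‖ ≤ 1`. [folklore] -/
theorem enorm_colEntryCLM_le (l k : Fin 3) : ‖colEntryCLM l k‖ₑ ≤ 1 := by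
  rw [← ofReal_norm, ← ENNReal.ofReal_one]
  refine ENNReal.ofReal_le_ofReal (ContinuousLinearMap.opNorm_le_bound _ zero_le_one fun R => ?_)
  rw [colEntryCLM_apply, one_mul]
  refine le_trans ?_ (norm_le_pi_norm R l)
  have h := PiLp.norm_apply_le (R l) k
  rw [Real.norm_eq_abs] at h
  exact h

/-- `ℓ^{-k}` as a real power is `(ℓ⁻¹)^k`. [folklore] -/
theorem rpow_neg_natCast_eq_inv_pow {ℓ : ℝ} (hℓ : 0 < ℓ) (k : ℕ) : ℓ ^ (-(k : ℝ)) = ℓ⁻¹ ^ k := by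
  rw [Real.rpow_neg hℓ.le, Real.rpow_natCast, inv_pow]

/-- **Entries of a matrix field inherit scaled bounds**: if `‖g‖_{C^k} ≤ Λ ℓ^{-k}` for `k ≤ K`
(elementwise sup norm) then each entry `x ↦ g(x)_{ab}` satisfies `BDSV.ScaledBound · K ℓ Λ`. [folklore] -/
theorem scaledBound_entry {g : 𝕋³ → 𝕄} (hg : IsSmooth g) {Λ : ℝ} (hℓ : 0 < ℓ)
    (h : ∀ k ≤ K, Torus.eContDiffHolderNorm k 0 g ≤ ENNReal.ofReal (Λ * ℓ ^ (-(k : ℝ))))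
    (a b : Fin 3) : ScaledBound (fun x => g x a b) K ℓ Λ := by
  intro k hk
  -- view `g` as valued in the Pi type (the elementwise matrix norm is the Pi norm)
  let g' : 𝕋³ → Fin 3 → Fin 3 → ℝ := g
  have hg' : IsContDiff k g' := hg.isContDiff (by exact_mod_cast le_top)
  have h1 : Torus.eContDiffHolderNorm k 0 (fun x => entryCLM a b (g' x)) ≤
      ‖entryCLM a b‖ₑ * Torus.eContDiffHolderNorm k 0 g' :=
    Torus.eContDiffHolderNorm_clm_comp_le _ hg' 0
  have h2 : Torus.eContDiffHolderNorm k 0 g' = Torus.eContDiffHolderNorm k 0 g := rfl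
  calc Torus.eContDiffHolderNorm k 0 (fun x => g x a b)
      = Torus.eContDiffHolderNorm k 0 (fun x => entryCLM a b (g' x)) := rfl
    _ ≤ ‖entryCLM a b‖ₑ * Torus.eContDiffHolderNorm k 0 g' := h1
    _ ≤ 1 * Torus.eContDiffHolderNorm k 0 g' := mul_le_mul' (enorm_entryCLM_le a b) le_rfl
    _ ≤ ENNReal.ofReal (Λ * ℓ⁻¹ ^ k) := by
        rw [one_mul, h2, ← rpow_neg_natCast_eq_inv_pow hℓ]
        exact h k hk

/-- **Entries of a column family inherit scaled bounds** (with an arbitrary Hölder exponent `r`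
on the field, dropped on the entry: `‖·‖_{k,0} ≤ 2‖·‖_{k,r}`... handled by the caller). [folklore] -/
theorem eContDiffHolderNorm_colEntry_le {R : 𝕋³ → Fin 3 → ℝ³} {k : ℕ} (hR : IsContDiff k R)
    (r : ℝ≥0) (l m : Fin 3) :
    Torus.eContDiffHolderNorm k r (fun x => R x l m) ≤ Torus.eContDiffHolderNorm k r R :=
  calc Torus.eContDiffHolderNorm k r (fun x => R x l m)
      = Torus.eContDiffHolderNorm k r (fun x => colEntryCLM l m (R x)) := rfl
    _ ≤ ‖colEntryCLM l m‖ₑ * Torus.eContDiffHolderNorm k r R :=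
        Torus.eContDiffHolderNorm_clm_comp_le _ hR r
    _ ≤ 1 * Torus.eContDiffHolderNorm k r R := mul_le_mul' (enorm_colEntryCLM_le l m) le_rfl
    _ = _ := one_mul _

/-- A constant function satisfies the scaled bound with its absolute value (`ℓ ≤ 1`). [folklore] -/
theorem scaledBound_const (c : ℝ) (K : ℕ) (hℓ : 0 < ℓ) (hℓ1 : ℓ ≤ 1) :
    ScaledBound (fun _ : 𝕋³ => c) K ℓ |c| := by
  intro k _
  refine (eContDiffHolderNorm_const_le k 0 c).trans ?_
  rw [← ofReal_norm, Real.norm_eq_abs]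
  refine ENNReal.ofReal_le_ofReal (le_mul_of_one_le_right (abs_nonneg c) ?_)
  exact one_le_pow₀ ((one_le_inv₀ hℓ).2 hℓ1)

end Entries

/-! ## The mean-free Mikado tensor as a zero-mean profile -/

section Profile

variable {r : ℝ}

/-- The entries of the fluctuation `G(R, ξ) = W ⊗ W - R` as parametrised profiles,
`(R, ξ) ↦ G(R, ξ)_{ab}`. [cite: BuckmasterEtAl2018, §5.1 (5.6)] -/
def MikadoDatum.fluctFam (𝔚 : MikadoDatum r) (a b : Fin 3) : 𝕄 → 𝕋³ → ℝ :=
  fun R ξ => 𝔚.fluct R ξ a b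

/-- **The zero-mean version of the fluctuation**, `G̃_{ab}(R, ξ) = G_{ab}(R, ξ) - ∫ G_{ab}(R, ·)`:
zero mean for EVERY `R` (so that the telescoping decomposition applies everywhere), and equal to
`G_{ab}` for `R` in the Mikado domain `𝒩` (where `⨍ W ⊗ W = R`). [folklore] -/
def MikadoDatum.fluctZ (𝔚 : MikadoDatum r) (a b : Fin 3) : 𝕄 → 𝕋³ → ℝ :=
  fun R ξ => 𝔚.fluctFam a b R ξ - ∫ ζ, 𝔚.fluctFam a b R ζ

variable (𝔚 : MikadoDatum r)

/-- `G_{ab}(R, ξ) = W_a W_b - R_{ab}`. [folklore] -/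
theorem MikadoDatum.fluctFam_apply (a b : Fin 3) (R : 𝕄) (ξ : 𝕋³) :
    𝔚.fluctFam a b R ξ = 𝔚.W R ξ a * 𝔚.W R ξ b - R a b := rfl

/-- The components `(R, ξ) ↦ W(R, ξ)_a` of a Mikado profile are jointly smooth. [folklore] -/
theorem MikadoDatum.jointSmooth_W (a : Fin 3) : JointSmooth fun R ξ => 𝔚.W R ξ a :=
  (EuclideanSpace.proj a : ℝ³ →L[ℝ] ℝ).contDiff.comp 𝔚.smooth_W

/-- The entries of the fluctuation are jointly smooth. [folklore] -/
theorem MikadoDatum.jointSmooth_fluctFam (a b : Fin 3) : JointSmooth (𝔚.fluctFam a b) := by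
  have hR : JointSmooth fun (R : 𝕄) (_ : 𝕋³) => R a b :=
    JointSmooth.of_contDiff (entryCLM a b).contDiff
  exact ((𝔚.jointSmooth_W a).mul (𝔚.jointSmooth_W b)).sub hR

/-- The zero-mean fluctuation is jointly smooth. [folklore] -/
theorem MikadoDatum.jointSmooth_fluctZ (a b : Fin 3) : JointSmooth (𝔚.fluctZ a b) :=
  (𝔚.jointSmooth_fluctFam a b).sub (JointSmooth.of_contDiff (𝔚.jointSmooth_fluctFam a b).contDiff_integral)

/-- The zero-mean fluctuation has zero mean for every `R`. [folklore] -/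
theorem MikadoDatum.integral_fluctZ (a b : Fin 3) (R : 𝕄) : ∫ ξ, 𝔚.fluctZ a b R ξ = 0 := by
  unfold MikadoDatum.fluctZ
  rw [integral_sub ((𝔚.jointSmooth_fluctFam a b).isSmooth R).integrable (integrable_const _)]
  simp

/-- **On the Mikado domain the fluctuation has zero mean**, so `G̃ = G` there:
for `R ∈ B̄(Id, r)` symmetric, `∫ (W_a W_b - R_{ab}) = R_{ab} - R_{ab} = 0`.
[cite: BuckmasterEtAl2018, Lemma 5.1 (⨍ W ⊗ W = R)] -/
theorem MikadoDatum.fluctZ_eq_of_mem (a b : Fin 3) {R : 𝕄}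
    (hR : R ∈ Metric.closedBall (1 : 𝕄) r) (hs : R.IsSymm) (ξ : 𝕋³) :
    𝔚.fluctZ a b R ξ = 𝔚.fluctFam a b R ξ := by
  have hWW := 𝔚.integral_WW R hR hs a b
  have hint : Integrable fun ζ => 𝔚.W R ζ a * 𝔚.W R ζ b :=
    (((𝔚.jointSmooth_W a).mul (𝔚.jointSmooth_W b)).isSmooth R).integrable
  have h0 : ∫ ζ, 𝔚.fluctFam a b R ζ = 0 := by
    simp only [MikadoDatum.fluctFam_apply]
    rw [integral_sub hint (integrable_const _), hWW]
    simp
  rw [MikadoDatum.fluctZ, h0, sub_zero]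

/-- **Uniform bounds for all descendants of the fluctuation** on the compact Mikado ball
`B̄(Id, r) × T³`, at any level `K` (a constant depending on the profile and `K` only). [folklore] -/
theorem MikadoDatum.exists_bound_descSet_fluctZ (K : ℕ) :
    ∃ U : ℝ, 0 ≤ U ∧ ∀ a b, ∀ v ∈ descSet K (𝔚.fluctZ a b),
      ∀ R ∈ Metric.closedBall (1 : 𝕄) r, ∀ ξ, |v R ξ| ≤ U := by
  have hK : IsCompact (Metric.closedBall (1 : 𝕄) r) := isCompact_closedBall _ _
  choose U hU0 hU using fun a b => exists_bound_descSet hK K (𝔚.fluctZ a b) (𝔚.jointSmooth_fluctZ a b)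
  refine ⟨∑ a, ∑ b, U a b, Finset.sum_nonneg fun a _ => Finset.sum_nonneg fun b _ => hU0 a b,
    fun a b v hv R hR ξ => (hU a b v hv R hR ξ).trans ?_⟩
  exact le_trans (Finset.single_le_sum (f := fun b => U a b) (fun b _ => hU0 a b) (Finset.mem_univ b))
    (Finset.single_le_sum (f := fun a => ∑ b, U a b)
      (fun a _ => Finset.sum_nonneg fun b _ => hU0 a b) (Finset.mem_univ a))

end Profile

/-! ## The trace of a conjugated matrix -/

section Trace

/-- `tr(A G Aᵀ) = ∑_{c,a,b} A_{ca} G_{ab} A_{cb}`. [folklore] -/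
theorem trace_mul_mul_transpose (A G : 𝕄) :
    Matrix.trace (A * G * Aᵀ) = ∑ c, ∑ a, ∑ b, A c a * G a b * A c b := by
  simp only [Matrix.trace, Matrix.diag_apply, Matrix.mul_apply, Matrix.transpose_apply,
    Finset.sum_mul]
  refine Finset.sum_congr rfl fun c _ => ?_
  rw [Finset.sum_comm]

end Trace

/-! ## Finite sums of scaled bounds -/

section Sums

variable {ι : Type*} {N : ℕ} {ℓ M : ℝ}

/-- Finite sums of functions with a common scaled bound. [folklore] -/
theorem ScaledBound.sum (s : Finset ι) {f : ι → 𝕋³ → ℝ} (h : ∀ i ∈ s, ScaledBound (f i) N ℓ M)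
    (hs : ∀ i ∈ s, IsSmooth (f i)) (hM : 0 ≤ M) (hℓ : 0 < ℓ) :
    ScaledBound (fun x => ∑ i ∈ s, f i x) N ℓ (s.card * M) := by
  classical
  induction s using Finset.induction_on with
  | empty =>
    intro j _
    simp only [Finset.sum_empty, Finset.card_empty, Nat.cast_zero, zero_mul]
    rw [show (fun _ : 𝕋³ => (0 : ℝ)) = fun _ => (0 : ℝ) • (0 : ℝ) by simp]
    refine (eContDiffHolderNorm_const_le j 0 _).trans ?_
    simp
  | insert a s ha ih =>
    have h1 : ScaledBound (f a) N ℓ M := h a (Finset.mem_insert_self a s)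
    have h2 : ScaledBound (fun x => ∑ i ∈ s, f i x) N ℓ (s.card * M) :=
      ih (fun i hi => h i (Finset.mem_insert_of_mem hi)) (fun i hi => hs i (Finset.mem_insert_of_mem hi))
    have hsm : IsSmooth fun x => ∑ i ∈ s, f i x :=
      Torus.isSmooth_finset_sum s fun i hi => hs i (Finset.mem_insert_of_mem hi)
    have h3 := h1.add h2 (hs a (Finset.mem_insert_self a s)) hsm hM (by positivity) hℓ
    simp only [Finset.sum_insert ha, Finset.card_insert_of_notMem ha, Nat.cast_succ]
    refine h3.mono_M (by ring_nf; nlinarith) hℓ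

end Sums

/-! ## The phase frame of the construction at an active time -/

section Frame

variable {P : Params} {S : Setting} {Nbar : ℕ} {Cin C₀ c₀ : ℝ} {Cη : ℕ → ℕ → ℝ}

/-- The smooth slice `x ↦ ∇Φ_i(t, x)` (as a matrix field) under the standing hypotheses. [folklore] -/
theorem PerturbationData.isSmooth_gradPhi (H : PerturbationHypotheses P S Nbar Cin C₀)
    (𝒟 : PerturbationData P S c₀ Cη) (i : ℕ) {t : ℝ} (ht : t ∈ Icc 0 S.T) :
    IsSmooth fun x => gradPhi 𝒟.D i t x :=
  isSmooth_matrix_of_entries fun a b =>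
    (isSmoothSpaceTimeOn_gradPhi H.pos_T (fun j => (𝒟.flow j).smooth) i a b).isSmooth_slice ht

/-- The slice `x ↦ R̃_{q,i}(t, x)` is smooth (for `ρ_q ≠ 0` on `[0,T]`). [folklore] -/
theorem PerturbationData.isSmooth_tildeR (H : PerturbationHypotheses P S Nbar Cin C₀)
    (𝒟 : PerturbationData P S c₀ Cη) (hρ : ∀ s ∈ Icc 0 S.T, rhoQ P S s ≠ 0) (i : ℕ) {t : ℝ}
    (ht : t ∈ Icc 0 S.T) : IsSmooth fun x => tildeR P S 𝒟.cut.η 𝒟.D i t x :=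
  isSmooth_matrix_of_entries fun a b =>
    (isSmoothSpaceTimeOn_tildeR H.pos_T H.profile.smooth H.eulerReynolds.smooth_velocity
      H.eulerReynolds.smooth_stress 𝒟.cut.smooth (fun j => (𝒟.flow j).smooth) hρ i a b).isSmooth_slice ht

/-- With `det ∇Φ_i = 1`, the matrix inverse `(∇Φ_i)⁻¹` is the adjugate. [folklore] -/
theorem PerturbationData.gradPhi_inv_eq_adjugate (H : PerturbationHypotheses P S Nbar Cin C₀)
    (𝒟 : PerturbationData P S c₀ Cη) (ha : 1 ≤ P.a) (i : ℕ) {t : ℝ} (ht : t ∈ Icc 0 S.T) :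
    (fun x => (gradPhi 𝒟.D i t x)⁻¹) = fun x => (gradPhi 𝒟.D i t x).adjugate := by
  funext x
  rw [Matrix.inv_def, 𝒟.det_gradPhi_eq_one H ha i ht x, Ring.inverse_one, one_smul]

/-- **Scaled bounds on the entries of the glued stress** from (2.20): `‖R̊̄_{lk}(t)‖_{C^k} ≤ 3 C_in δ_{q+1} ℓ^α · ℓ^{-k}`
for `k ≤ K ≤ N̄`. [cite: BuckmasterEtAl2018, §2.5 (2.20)] -/
theorem PerturbationHypotheses.scaledBound_Rbar (H : PerturbationHypotheses P S Nbar Cin C₀)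
    (ha : 1 ≤ P.a) {K : ℕ} (hK : K ≤ Nbar) {t : ℝ} (ht : t ∈ Icc 0 S.T) (l k : Fin 3) :
    ScaledBound (fun x => S.Rbar t x l k) K (mollScale P.β P.α P.a P.b S.q)
      (3 * (Cin * (amp P.β P.a P.b (S.q + 1) * mollScale P.β P.α P.a P.b S.q ^ P.α))) := by
  intro j hj
  have hℓ := mollScale_pos (β := P.β) (α := P.α) (b := P.b) ha S.q
  have hRs : IsSmooth (S.Rbar t) := H.eulerReynolds.smooth_stress.isSmooth_slice ht
  have hs := H.stress j (hj.trans hK) t ht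
  calc Torus.eContDiffHolderNorm j 0 (fun x => S.Rbar t x l k)
      ≤ 3 * Torus.eContDiffHolderNorm j (Real.toNNReal P.α) (fun x => S.Rbar t x l k) :=
        Torus.eContDiffHolderNorm_exponent_zero_le j _ _
    _ ≤ 3 * Torus.eContDiffHolderNorm j (Real.toNNReal P.α) (S.Rbar t) :=
        mul_le_mul' le_rfl (eContDiffHolderNorm_colEntry_le (hRs.isContDiff (by exact_mod_cast le_top)) _ l k)
    _ ≤ 3 * ENNReal.ofReal (Cin * (amp P.β P.a P.b (S.q + 1) *
          mollScale P.β P.α P.a P.b S.q ^ (-(j : ℝ) + P.α))) := mul_le_mul' le_rfl hs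
    _ = ENNReal.ofReal (3 * (Cin * (amp P.β P.a P.b (S.q + 1) * mollScale P.β P.α P.a P.b S.q ^ P.α)) *
          (mollScale P.β P.α P.a P.b S.q)⁻¹ ^ j) := by
        rw [← ENNReal.ofReal_ofNat 3, ← ENNReal.ofReal_mul (by norm_num), Real.rpow_add hℓ,
          rpow_neg_natCast_eq_inv_pow hℓ]
        ring_nf

/-- The constant `Λ` of the frame: dominates the bounds on `∇Φ_i`, `adj ∇Φ_i` (`C_J`) and on the
entries of `R̃_{q,i}` (`9 (3^K(K+1))² C_J² (1 + 24 C_in)`). [folklore] -/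
def frameConst (K : ℕ) (CJ Cin : ℝ) : ℝ :=
  1 + CJ + 9 * ((3 : ℝ) ^ K * (K + 1)) ^ 2 * CJ ^ 2 * (1 + 24 * Cin)

/-- `1 ≤ frameConst`, `CJ ≤ frameConst`, and the `R̃` bound is below `frameConst`. [folklore] -/
theorem frameConst_bounds (K : ℕ) {CJ Cin : ℝ} (hCJ : 0 ≤ CJ) (hCin : 0 ≤ Cin) :
    1 ≤ frameConst K CJ Cin ∧ CJ ≤ frameConst K CJ Cin ∧
      9 * ((3 : ℝ) ^ K * (K + 1)) ^ 2 * CJ ^ 2 * (1 + 24 * Cin) ≤ frameConst K CJ Cin := by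
  unfold frameConst
  have h : 0 ≤ 9 * ((3 : ℝ) ^ K * (K + 1)) ^ 2 * CJ ^ 2 * (1 + 24 * Cin) := by positivity
  exact ⟨by linarith, by linarith, by linarith⟩

/-- **Scaled bounds on the entries of `R̃_{q,i}`** (the content of Prop. 5.7, arXiv (5.24):
`‖R̃_{q,i}‖_N ≲ ℓ^{-N}`): from the all-orders bounds `‖∇Φ_i(t)‖_{C^k} ≤ C_J ℓ^{-k}` (`k ≤ K`),
(2.20) for `k ≤ K ≤ N̄`, `4δ_{q+2} ≤ δ_{q+1}λ_q^{-α}` and `λ_q^αℓ^α ≤ 1`, by the Leibniz rule for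
`R̃ = ∇Φ (Id - c R̊̄) ∇Φᵀ`. [cite: BuckmasterEtAl2018, Prop. 5.7 (arXiv (5.24))] -/
theorem PerturbationData.scaledBound_tildeR (H : PerturbationHypotheses P S Nbar Cin C₀)
    (𝒟 : PerturbationData P S c₀ Cη) (hCin : 0 ≤ Cin) (ha : 1 ≤ P.a) (hb : 1 ≤ P.b) (hβ : 0 ≤ P.β)
    (hα : 0 ≤ P.α)
    (h4 : 4 * amp P.β P.a P.b (S.q + 2) ≤ amp P.β P.a P.b (S.q + 1) * freq P.a P.b S.q ^ (-P.α))
    {K : ℕ} (hK : K ≤ Nbar) {CJ : ℝ} (hCJ : 0 ≤ CJ) {i : ℕ} {t : ℝ} (ht : t ∈ Icc 0 S.T)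
    (hJ : ∀ k ≤ K, Torus.eContDiffHolderNorm k 0 (fun x => gradPhi 𝒟.D i t x) ≤
      ENNReal.ofReal (CJ * mollScale P.β P.α P.a P.b S.q ^ (-(k : ℝ))))
    (a b : Fin 3) :
    ScaledBound (fun x => tildeR P S 𝒟.cut.η 𝒟.D i t x a b) K (mollScale P.β P.α P.a P.b S.q)
      (9 * ((3 : ℝ) ^ K * (K + 1)) ^ 2 * CJ ^ 2 * (1 + 24 * Cin)) := by
  set ℓ := mollScale P.β P.α P.a P.b S.q with hℓdef
  have hℓ : 0 < ℓ := mollScale_pos ha _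
  have hℓ1 : ℓ ≤ 1 := (one_le_inv₀ hℓ).1 (one_le_mollScale_inv ha hb hβ hα _)
  have hδ : 0 < amp P.β P.a P.b (S.q + 1) := amp_pos ha _
  set c : ℝ := etaMass P S 𝒟.cut.η t / rhoQ P S t with hcdef
  obtain ⟨hc0, hcle⟩ := 𝒟.etaMass_div_rhoQ_le H ha h4 ht
  -- the players and their smoothness
  have hJs : IsSmooth fun x => gradPhi 𝒟.D i t x := 𝒟.isSmooth_gradPhi H i ht
  have hJe : ∀ p q : Fin 3, IsSmooth fun x => gradPhi 𝒟.D i t x p q := fun p q => isSmooth_entry hJs p q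
  have hRs : IsSmooth (S.Rbar t) := H.eulerReynolds.smooth_stress.isSmooth_slice ht
  have hRe : ∀ l k : Fin 3, IsSmooth fun x => S.Rbar t x l k := fun l k =>
    (hRs.comp_clm (ContinuousLinearMap.proj (R := ℝ) (φ := fun _ : Fin 3 => ℝ³) l)).apply k
  -- scaled bounds: `∇Φ`, the middle matrix `M = Id - c R̊̄ᵀ`
  have hJB : ∀ p q : Fin 3, ScaledBound (fun x => gradPhi 𝒟.D i t x p q) K ℓ CJ := fun p q =>
    scaledBound_entry hJs hℓ hJ p q
  set M₀ : ℝ := 1 + 24 * Cin with hM₀def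
  have hM₀ : 0 ≤ M₀ := by positivity
  have hMB : ∀ k l : Fin 3, ScaledBound (fun x => (1 : 𝕄) k l - c * S.Rbar t x l k) K ℓ M₀ := by
    intro k l
    have h1 : ScaledBound (fun _ : 𝕋³ => (1 : 𝕄) k l) K ℓ 1 := by
      refine (scaledBound_const ((1 : 𝕄) k l) K hℓ hℓ1).mono_M ?_ hℓ
      rw [Matrix.one_apply]
      split_ifs <;> simp
    have h2 : ScaledBound (fun x => c * S.Rbar t x l k) K ℓ (24 * Cin) := by
      have h3 := (H.scaledBound_Rbar ha hK ht l k).const_mul (hRe l k) c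
      refine h3.mono_M ?_ hℓ
      rw [abs_of_nonneg hc0]
      have hX := freq_rpow_mul_mollScale_rpow_le_one_of_nonneg ha hb hβ hα S.q (β := P.β) (α := P.α)
      calc c * (3 * (Cin * (amp P.β P.a P.b (S.q + 1) * ℓ ^ P.α)))
          ≤ (8 * freq P.a P.b S.q ^ P.α / amp P.β P.a P.b (S.q + 1)) *
              (3 * (Cin * (amp P.β P.a P.b (S.q + 1) * ℓ ^ P.α))) :=
            mul_le_mul_of_nonneg_right hcle (by positivity)
        _ = 24 * Cin * (freq P.a P.b S.q ^ P.α * ℓ ^ P.α) := by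
            rw [div_mul_eq_mul_div, div_eq_iff hδ.ne']
            ring
        _ ≤ 24 * Cin * 1 := mul_le_mul_of_nonneg_left hX (by positivity)
        _ = 24 * Cin := mul_one _
    have h4' := h1.sub h2 (isSmooth_const _) ((isSmooth_const _).mul (hRe l k)) zero_le_one
      (by positivity) hℓ
    exact h4'
  have hMs : ∀ k l : Fin 3, IsSmooth fun x => (1 : 𝕄) k l - c * S.Rbar t x l k := fun k l =>
    (isSmooth_const _).sub ((isSmooth_const _).mul (hRe l k))
  -- the entry of `R̃ = J M Jᵀ`
  set c₁ : ℝ := (3 : ℝ) ^ K * (K + 1) with hc₁def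
  have hc₁ : 0 ≤ c₁ := by positivity
  have hinner : ∀ l : Fin 3, ScaledBound
      (fun x => ∑ k, gradPhi 𝒟.D i t x a k * ((1 : 𝕄) k l - c * S.Rbar t x l k)) K ℓ
      (3 * (c₁ * CJ * M₀)) := by
    intro l
    have h := ScaledBound.sum (Finset.univ : Finset (Fin 3))
      (f := fun k x => gradPhi 𝒟.D i t x a k * ((1 : 𝕄) k l - c * S.Rbar t x l k))
      (fun k _ => (hJB a k).mul (hMB k l) (hJe a k) (hMs k l) hCJ hM₀ hℓ)
      (fun k _ => (hJe a k).mul (hMs k l)) (by positivity) hℓ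
    simp only [Finset.card_univ, Fintype.card_fin, Nat.cast_ofNat] at h
    refine h.mono_M (le_of_eq ?_) hℓ
    rw [hc₁def]
  have hinner_s : ∀ l : Fin 3, IsSmooth
      (fun x => ∑ k, gradPhi 𝒟.D i t x a k * ((1 : 𝕄) k l - c * S.Rbar t x l k)) := fun l =>
    Torus.isSmooth_finset_sum _ fun k _ => (hJe a k).mul (hMs k l)
  have houter := ScaledBound.sum (Finset.univ : Finset (Fin 3))
    (f := fun l x => (∑ k, gradPhi 𝒟.D i t x a k * ((1 : 𝕄) k l - c * S.Rbar t x l k)) *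
      gradPhi 𝒟.D i t x b l)
    (fun l _ => (hinner l).mul (hJB b l) (hinner_s l) (hJe b l) (by positivity) hCJ hℓ)
    (fun l _ => (hinner_s l).mul (hJe b l)) (by positivity) hℓ
  simp only [Finset.card_univ, Fintype.card_fin, Nat.cast_ofNat] at houter
  have heq : (fun x => tildeR P S 𝒟.cut.η 𝒟.D i t x a b) = fun x => ∑ l,
      (∑ k, gradPhi 𝒟.D i t x a k * ((1 : 𝕄) k l - c * S.Rbar t x l k)) * gradPhi 𝒟.D i t x b l := by
    funext x
    simp only [tildeR, Matrix.mul_apply, Matrix.transpose_apply, Matrix.sub_apply, Matrix.smul_apply,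
      ofCols_apply, smul_eq_mul, hcdef]
  rw [heq]
  refine houter.mono_M (le_of_eq ?_) hℓ
  rw [hc₁def]
  ring

/-- **The phase frame of the construction**: under the standing hypotheses with `C_in ≥ 0`,
`a ≥ 1`, the parameter conditions of Lemma 5.4 (`4δ_{q+2} ≤ δ_{q+1}λ_q^{-α}`, the deformation
and stress thresholds) and the all-orders bounds
`‖∇Φ_i(t)‖_{C^k}, ‖∇Φ_i(t)⁻¹‖_{C^k} ≤ C_J ℓ^{-k}` (`k ≤ K ≤ N̄`) at a time `t ∈ [0,T]` at which
`η_i(t,·)` does not vanish identically, the data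
`(R̃_{q,i}(t,·), D_i(t,·), n_{q+1}, K, ℓ, Λ, B̄(Id, 1/10))` form a `BDSV.PhaseFrame` with
`Λ = BDSV.frameConst K C_J C_in`. [cite: BuckmasterEtAl2018, Lemma 5.4 and Prop. 5.7] -/
theorem PerturbationData.phaseFrame (H : PerturbationHypotheses P S Nbar Cin C₀)
    (𝒟 : PerturbationData P S c₀ Cη) (hCin : 0 ≤ Cin) (ha : 1 ≤ P.a) (hb : 1 ≤ P.b) (hβ : 0 ≤ P.β)
    (hα : 0 ≤ P.α)
    (h4 : 4 * amp P.β P.a P.b (S.q + 2) ≤ amp P.β P.a P.b (S.q + 1) * freq P.a P.b S.q ^ (-P.α))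
    (hdef : Real.exp (4 * (Cin * mollScale P.β P.α P.a P.b S.q ^ (2 * P.α))) - 1 ≤ 1 / 300)
    (hstr : 8 * (Cin * (freq P.a P.b S.q ^ P.α * mollScale P.β P.α P.a P.b S.q ^ P.α)) ≤ 1 / 100)
    {K : ℕ} (hK : K ≤ Nbar) {CJ : ℝ} (hCJ : 0 ≤ CJ) {i : ℕ} {t : ℝ} (ht : t ∈ Icc 0 S.T)
    (hJ : ∀ k ≤ K, Torus.eContDiffHolderNorm k 0 (fun x => gradPhi 𝒟.D i t x) ≤
      ENNReal.ofReal (CJ * mollScale P.β P.α P.a P.b S.q ^ (-(k : ℝ))))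
    (hJinv : ∀ k ≤ K, Torus.eContDiffHolderNorm k 0 (fun x => (gradPhi 𝒟.D i t x)⁻¹) ≤
      ENNReal.ofReal (CJ * mollScale P.β P.α P.a P.b S.q ^ (-(k : ℝ))))
    {x' : 𝕋³} (hη : 𝒟.cut.η i t x' ≠ 0) :
    PhaseFrame (fun x => tildeR P S 𝒟.cut.η 𝒟.D i t x) (𝒟.D i t) (P.freqNat (S.q + 1)) K
      (mollScale P.β P.α P.a P.b S.q) (frameConst K CJ Cin)
      (Metric.closedBall (1 : 𝕄) mikadoRadius) := by
  have hℓ : 0 < mollScale P.β P.α P.a P.b S.q := mollScale_pos ha _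
  have hρpos : ∀ s ∈ Icc 0 S.T, 0 < rhoQ P S s := fun s hs =>
    lt_of_lt_of_le (div_pos (mul_pos (amp_pos ha _) (Real.rpow_pos_of_pos (freq_pos ha _) _))
      (by norm_num)) (H.le_rhoQ h4 hs)
  obtain ⟨hΛ1, hΛJ, hΛR⟩ := frameConst_bounds K hCJ hCin
  have hJs : IsSmooth fun x => gradPhi 𝒟.D i t x := 𝒟.isSmooth_gradPhi H i ht
  have hadj : ∀ m j, ScaledBound (fun x => (jac (𝒟.D i t) x).adjugate m j) K
      (mollScale P.β P.α P.a P.b S.q) CJ := by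
    intro m j
    have hinv_s : IsSmooth fun x => (gradPhi 𝒟.D i t x)⁻¹ := by
      rw [𝒟.gradPhi_inv_eq_adjugate H ha i ht]
      exact isSmooth_matrix_of_entries fun p q =>
        isSmooth_adjugate_jac_entry ((𝒟.flow i).smooth.isSmooth_slice ht) p q
    have h := scaledBound_entry hinv_s hℓ hJinv m j
    have heq : (fun x => (gradPhi 𝒟.D i t x)⁻¹ m j) = fun x => (jac (𝒟.D i t) x).adjugate m j := by
      funext x
      have := congrFun (𝒟.gradPhi_inv_eq_adjugate H ha i ht) x
      rw [this]
      rfl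
    rw [heq] at h
    exact h
  exact
    { smooth_Rt := 𝒟.isSmooth_tildeR H (fun s hs => (hρpos s hs).ne') i ht
      smooth_D := (𝒟.flow i).smooth.isSmooth_slice ht
      n_pos := P.freqNat_pos ha _
      ℓ_pos := hℓ
      ℓ_le_one := (one_le_inv₀ hℓ).1 (one_le_mollScale_inv ha hb hβ hα _)
      one_le_Λ := hΛ1
      det_jac := fun x => 𝒟.det_gradPhi_eq_one H ha i ht x
      adj_bound := fun m j => (hadj m j).mono_M hΛJ hℓ
      Rt_bound := fun a b =>
        (𝒟.scaledBound_tildeR H hCin ha hb hβ hα h4 hK hCJ ht hJ a b).mono_M hΛR hℓ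
      isCompact := isCompact_closedBall _ _
      mem := fun x => 𝒟.tildeR_mem_closedBall H hCin ha hdef hstr h4 ht hη x }

end Frame

end BDSV

end Literature.Analysis.FluidPDE
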